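import Mathlib
import HarnessLib

/-!
# Joshi's prime bundling rings `B̆_{L′,p}`, `B̑_p`, the tensor-product rings `B̆⊗_{L′,p}` and the tensor form of
# his «fundamental estimate» (ATS III §7.5 + §7.7), typed over an abstract carrier

Block E of the abc-iut cell (rung LADDER-ABC:A2.E; seat abc-iut-E-t13, slot T-13 of `plan/E/ASSIGNMENTS.md`; inventory
`plan/E/t13/INVENTORY.tsv`): TYPE the OBJECTS of K. Joshi, *Construction of Arithmetic Teichmüller Spaces III*, arXiv:2401.13508**v4**
(«Preliminary version for comments», UNREFEREED; bib `Joshi2024ATS3`; rejected by the IUT author, `Mochizuki2024JoshiReport`), **§7.5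
«Prime Bundling rings» (pp. 57–60) and §7.7 «The fundamental estimate for `Θ̃^{B̆⊗}_Joshi`» (pp. 65–67)**. Locators «p. N l. a–b» =
PDF page N, lines a–b of the cell's render `HOME/lit/renders/Joshi-arxiv-2401.13508/pNNNN.txt`. NO SIDE TAKEN on [IUTchIII] Cor. 3.12,
on Joshi's claims or on Mochizuki's reports on them. TYPED ≠ PROVED ≠ ENDORSED: every statement Joshi ASSERTS is a `def … : Prop`
tagged `@[claim "Joshi2024ATS3" "disputed"]`, never an axiom / instance / `sorry` / Literature fact; what FOLLOWS from the typed
signature is a proved `theorem`. No input from our frozen interface is consumed; no test is filed here.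

INTERIM CARRIER RULE (ASSIGNMENTS §0.3): self-contained over `PrimeBundlingDatum lstar` (what §7.5/§7.7 use at ONE rational prime `p`)
and `PrimeBundlingFamily lstar` (the finite family over `p`). MERGE-DEBTS: `Bp`, `BE w`, `nrm` (E-t3 `PeriodRingDatum`, E-t12 `AdelicThetaDatum.B/nrm`, E-t9 J3
§5.2) · `locusBE w` = `Θ̃^{B_{E′_w}}_{Joshi}` (E-t3 arXiv:2303.01662 Def. 8.3.1; E-t10/E-t11 J3 §6) · `normT`/`CrossNormAt` (E-t14 J3
§7.6) · size recipe J3 Def. 7.2.7 (E-t12) · `qRoot` (E-t6/E-t11) · (7.5.1.6) / Thm. 7.5.4.2 vs E-t11's adelic `B_{L′}`, `Θ̃^{B_{L′}}_{Joshi}`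
(J3 Def. 6.9.1 / 6.10.2) · DOWNSTREAM E-t15 `ATS3.BundlingDatum K B A W J` (ThetaLociProducts.lean, §7.8) is instantiated by
`K := Qp`, `B := Bp`, `A := BundleTensE` (his `B̆_p`), `W := ↥Vss`, `J := Fin lstar`, `thetaLocus :=` the image of `locusBundled`.
DERIVED in kernel: Lem. 7.5.1.9, Lem. 7.5.2.3, (7.5.2.2), **Thm. 7.7.3.1** (local and adelic) from the two
inputs its proof names. The `B̑⊗` twin («a similar assertion») = the same signature with `BE w := B ⊗_{ℚ_p} E′_w`.

PRINT NOTES (own reading, for the referee lanes; no adjudication): (a) in the proof of Thm. 7.7.3.1, (7.7.3.3)/(7.7.3.4) print the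
per-`w` bound WITHOUT the exponent `ℓ⋇` of the statement; consistent iff `|Z_w|_{B_{E′_w},ρ}` is the `ℓ⋇`-fold product size (7.2.2) of
the tuple `Z_w` — typed so (`localSize`); (b) p. 67 l. 46–47 «the claim of Theorem 7.3.1 follows» sic = 7.7.3.1; (c) (7.5.3.1) has
superscript `B̑_p` but displays the target `⊕_w B_{E′_w}`; (d) the §7.5 title names TWO rings the render prints alike («˘B»):
(7.5.1.5) sums `B_{E′_w}` over ALL `w | p`, (7.5.2.1) sums `B ⊗_{ℚ_p} E′_w` over `w ∈ 𝕍^{odd,ss}_p` — `BundleAll` / `BundleTensE` here;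
(e) §7.7.1's tensor products are UNCOMPLETED by the author's choice (p. 65 l. 36–37). SHAPE NOTE (dictionary level, not a test):
Thm. 7.7.3.1 bounds a size from below by EXHIBITING ONE member — the shape of `Cor312LogKummerRoute.VolumeTransport`, not of the
residual `Cor312Vol.PilotKummerIndRelated`; Joshi: the bundling «allows me to demonstrate the tensor packet structure of [Mochizuki,
2021c, Section 3]» (p. 57 l. 54–56) ↔ our `Thm311.LogShells.Packet`. Standard axioms; sorry-free.
-/

noncomputable section

open Set
open scoped TensorProduct

namespace Summit.ABC.IUTFork.Joshi.ATS3

/-! ## 1. The local carrier at one rational prime `p` (§7.5.1, §7.5.2, §7.7.1, §7.7.2) -/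

/-- **`PrimeBundlingDatum` — what J3 §7.5 / §7.7 use at ONE rational prime `p`** (notations of §2.4, §3.1, §3.3 in force, p. 57
l. 64; `ℓ⋇ = (ℓ−1)/2` is the parameter `lstar`). UNBUNDLED CARRIERS (parameters, Mathlib instances): `Qp` = the base field `ℚ_p`;
`Bp` = the ring `B_p = B_{ℂ_p^♭,ℚ_p}` (J3 §5.2; E-t9/E-t3); `I` = the finite index set `𝕍_{L′,p} = {w ∈ 𝕍_{L′} : w | p}` (7.5.1.1,
p. 58 l. 2); `E w` = the fields `E′_w := L′_w` (p. 58 l. 45–47); `BE w` = the rings `B_{E′_w}` as commutative `ℚ_p`- and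
`B_p`-algebras («`B_{E′_w} = B_p ⊗_{E′_{w,0}} E′_w`», p. 58 l. 70–76; E-t12's `AdelicThetaDatum.B`); `T` = the tensor-product ring
(7.7.1.1) `B̆⊗_{L′,p} = ⊗_{w∈𝕍^{odd,ss}_p} B_{E′_w}` over `ℚ_p` (p. 65 l. 14–37), an abstract commutative ring GIVEN WITH «the homomorphism (given by the
construction of tensor products) `∏_w B_{E′_w} → B̆⊗_{L′,p}`, `(x_w)_w ↦ ⊗_w x_w`» (p. 65 l. 40–56), typed as a monoid homomorphism
(multiplicative, unital, NOT additive); Joshi's literal construction instantiates both (`tensorModel`, `tensorModelTprod`). The loci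
`locusBE w` are INPUT («all possible lifts (as constrained in [Joshi, 2023b, §8])», p. 59 l. 75–80). SIGNATURE ONLY — no property
of the data is asserted. [claim: Joshi2024ATS3, status: disputed] -/
structure PrimeBundlingDatum (lstar : ℕ) (Qp Bp : Type) [Field Qp] [CommRing Bp] [Algebra Qp Bp] (I : Type) [Fintype I]
    [DecidableEq I] (E BE : I → Type) [∀ w, Field (E w)] [∀ w, Algebra Qp (E w)] [∀ w, CommRing (BE w)] [∀ w, Algebra Qp (BE w)]
    [∀ w, Algebra Bp (BE w)] (T : Type) [CommRing T] : Type where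
  /-- `𝕍_p = {w ∈ 𝕍 : w | p}` (7.5.1.2) -/
  Vp : Finset I
  /-- `𝕍^{odd,ss}_p = {w ∈ 𝕍^{odd,ss} : w | p}` (7.5.1.3) — E-t12's `AdelicThetaDatum.Vss` cut down to the primes over `p` -/
  Vss : Finset I
  /-- `𝕍^{odd,ss} ⊂ 𝕍` (J3 §3.3) -/
  Vss_subset : Vss ⊆ Vp
  /-- the Fréchet norms `|−|_{B_{E′_w};ρ}`, `ρ ∈ [0,1]` ([FF18 Déf. 1.10.2]; p. 61 l. 8–11) — E-t12's `AdelicThetaDatum.nrm` -/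
  nrm : (w : I) → ℝ → BE w → ℝ
  /-- … are non-negative -/
  nrm_nonneg : ∀ w ρ x, 0 ≤ nrm w ρ x
  /-- the comparison maps `B_{E′_w} → B ⊗_{ℚ_p} E′_w` of (7.5.2.2) -/
  toTensE : (w : I) → BE w →ₗ[Qp] Bp ⊗[Qp] E w
  /-- INPUT: the local theta-values loci `Θ̃^{B_{E′_w}}_{Joshi} ⊂ B_{E′_w}^{ℓ⋇}` -/
  locusBE : (w : I) → Set (Fin lstar → BE w)
  /-- the pure-tensor homomorphism `(x_w)_w ↦ ⊗_w x_w` of §7.7.2 -/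
  tprod : ((w : Vss) → BE w.1) →* T
  /-- the tensor-product norms `|−|_{B̆⊗;ρ}` (J3 §7.6, E-t14) -/
  normT : ℝ → T → ℝ
  /-- … are non-negative -/
  normT_nonneg : ∀ ρ t, 0 ≤ normT ρ t
  /-- `|q_w^{1/2ℓ}|_{ℂ_{p_w}}` for `w ∈ 𝕍^{odd,ss}_p`, valuation normalised by `|π_w|_{ℂ_{p_w}} = p_w^{-1}` (p. 66 l. 65–71); in
  E-t12's `AdelicThetaDatum`: `qAbs w ^ (1/(2ℓ))` -/
  qRoot : I → ℝ
  /-- … positive (`q_w ≠ 0`; E-t12 `qAbs_pos`) -/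
  qRoot_pos : ∀ w ∈ Vss, 0 < qRoot w

namespace PrimeBundlingDatum

variable {lstar : ℕ} {Qp Bp : Type} [Field Qp] [CommRing Bp] [Algebra Qp Bp] {I : Type} [Fintype I] [DecidableEq I]
  {E BE : I → Type} [∀ w, Field (E w)] [∀ w, Algebra Qp (E w)] [∀ w, CommRing (BE w)] [∀ w, Algebra Qp (BE w)]
  [∀ w, Algebra Bp (BE w)] {T : Type} [CommRing T] (D : PrimeBundlingDatum lstar Qp Bp I E BE T)

/-- **(7.5.1.5) the prime bundling ring `B̆_{L′,p} := ⊕_{w ∈ 𝕍_{L′,p}} B_{E′_w}`** (p. 58 l. 48–57; «`B̆_p`» when `L′`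
is clear): a finite direct sum of rings, typed as the product ring (`Pi.commRing`); «elements of `B̆_p` [have]
coordinates indexed by the set `{E′_w : w ∈ 𝕍_{L′,p}}`» (Rmk. 7.5.1.7, (7.5.1.8), p. 58 l. 63–68).
[claim: Joshi2024ATS3, status: disputed] -/
abbrev BundleAll (_ : PrimeBundlingDatum lstar Qp Bp I E BE T) : Type := (w : I) → BE w

/-- **(7.5.1.4) the odd-semistable part `⊕_{w ∈ 𝕍^{odd,ss}_p} B_{E′_w}`**, in whose `ℓ⋇`-tuples `Fin lstar → D.BundleOdd` «the local
components `{Θ̃^{B_{E′_w}}_{Joshi} : w ∈ 𝕍^{odd,ss}_p}` … can be viewed» (p. 58 l. 11–44; Rmk. 7.5.1.7). [claim: Joshi2024ATS3, status: disputed] -/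
abbrev BundleOdd : Type := (w : D.Vss) → BE w.1

/-- **Lemma 7.5.1.9, its per-factor input** (p. 58 l. 70–77: «`B_{E′_w} = B_p ⊗_{E′_{w,0}} E′_w` … is a finite module
over `B_p`», a [FF18] fact Joshi invokes). NAMED HYPOTHESIS, never asserted. [claim: Joshi2024ATS3, status: disputed] -/
@[claim "Joshi2024ATS3" "disputed"]
def FactorsFiniteOverBp (_ : PrimeBundlingDatum lstar Qp Bp I E BE T) : Prop := ∀ w : I, Module.Finite Bp (BE w)

/-- **Lemma 7.5.1.9** (p. 58 l. 69: «For each `p`, `B̆_{L′,p}` is a finite module over `B_p`») DERIVED from its per-factor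
input («and so the assertion follows», l. 77): a finite product of finite `B_p`-modules is finite (`Module.Finite.pi`). [folklore] -/
theorem bundleAll_finite_of_factors (h : D.FactorsFiniteOverBp) : Module.Finite Bp D.BundleAll := by
  haveI : ∀ w : I, Module.Finite Bp (BE w) := h
  exact Module.Finite.pi

/-- **(7.5.2.1) the ring `B̑_p := ⊕_{w ∈ 𝕍^{odd,ss}_p} (B ⊗_{ℚ_p} E′_w)`** (p. 59 l. 17–27; motivation p. 58 l. 78 – p. 59 l. 16: when
every `f(w|p) = 1`, `B̆_{L′,p} = B ⊗_{ℚ_p} (⊕_w E′_w)`; «In general this condition … does not hold»), with Mathlib's `TensorProduct`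
over the base field of the datum. [claim: Joshi2024ATS3, status: disputed] -/
abbrev BundleTensE : Type := (w : D.Vss) → Bp ⊗[Qp] E w.1

/-- **Lemma 7.5.2.3, DERIVED** (p. 59 l. 44–57: «`B̑_p = B ⊗_{ℚ_p} (⊕_{w ∈ 𝕍^{odd,ss}_p} E′_w)` … immediate from the definition»):
tensor product commutes with finite direct sums, as `B_p`-algebras (`Algebra.TensorProduct.piRight`); its inverse is the «presentation»
field `BundlingDatum.bundlingIso` of E-t15's ThetaLociProducts.lean ((7.8.1.3)), modulo E-t15's choice `E′_w ⊂ Q̄_p`. [folklore] -/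
def bundleTensEEquiv : Bp ⊗[Qp] ((w : D.Vss) → E w.1) ≃ₐ[Bp] D.BundleTensE :=
  Algebra.TensorProduct.piRight Qp Bp Bp (fun w : D.Vss => E w.1)

/-- **(7.5.2.2), the map** «using the fact that `B_E ↪ B ⊗_{ℚ_p} E` one has `(⊕_{w∈𝕍^{odd,ss}_p} B_{E′_w})^{ℓ⋇} ↪ B̑_p^{ℓ⋇}`»
(p. 59 l. 28–41): the componentwise comparison map (coordinatewise on `ℓ⋇`-tuples). [claim: Joshi2024ATS3, status: disputed] -/
def bundleOddToTensE : D.BundleOdd →ₗ[Qp] D.BundleTensE :=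
  LinearMap.pi fun w : D.Vss => (D.toTensE w.1).comp (LinearMap.proj w)

/-- The [FF18] input of (7.5.2.2) as a NAMED HYPOTHESIS: each `B_{E′_w} → B ⊗_{ℚ_p} E′_w`, `w ∈ 𝕍^{odd,ss}_p`, is
injective (p. 59 l. 28). Never asserted. [claim: Joshi2024ATS3, status: disputed] -/
@[claim "Joshi2024ATS3" "disputed"]
def ToTensEInjective : Prop := ∀ w ∈ D.Vss, Function.Injective (D.toTensE w)

/-- **(7.5.2.2) DERIVED**: given the [FF18] input, `⊕_w B_{E′_w} → B̑_p` is injective («The theta-values locus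
obviously embeds in `B̑_p^{ℓ⋇}` by means of the diagonal embedding», p. 59 l. 42–43). [folklore] -/
theorem bundleOddToTensE_injective (h : D.ToTensEInjective) : Function.Injective D.bundleOddToTensE :=
  fun _ _ hxy => funext fun w => h w.1 w.2 (congrFun hxy w)

/-- **(7.5.3.1) the bundled theta-values locus `Θ̃^{B̆}_{Joshi,p} := ⊕_{w ∈ 𝕍^{odd,ss}_p} Θ̃^{E′_w}_{Joshi,p} ↪ ⊕_w B_{E′_w}`** (p. 59
l. 58–80: «assembles together the collection of all possible lifts … viewed as lifts in `B_{E′_w} ⊂ B̆_p` for each `w`»): the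
`ℓ⋇`-tuples of `⊕_w B_{E′_w}` whose `w`-component lies in the input locus for every `w` (the «direct sum of subsets» = product
set), inside `(⊕_w B_{E′_w})^{ℓ⋇}` (7.5.1.4). Thm. 7.5.4.2's local clause «`Θ̃^{B̆}_{Joshi,p} ⊂ B̆_p^{ℓ⋇}`» (p. 60 l. 37–40) holds by
construction (a `Set` of that type); §7.5.4 (p. 59 l. 81 – p. 60 l. 22) lists the VARIANTS for the rings `B_p, B_p[1/t], B_e, B̆_p,
B̆_p[1/t], B̑_p, B̑_p[1/t], B_dR` — the signature is parametric in `BE`: each is an instance. [claim: Joshi2024ATS3, status: disputed] -/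
def locusBundled : Set (Fin lstar → D.BundleOdd) :=
  {z | ∀ w : D.Vss, (fun j => z j w) ∈ D.locusBE w.1}

/-- **MODEL of (7.7.1.1)**: Joshi's literal `B̆⊗_{L′,p} := ⊗_{w ∈ 𝕍^{odd,ss}_p} B_{E′_w}` as Mathlib's (uncompleted, as in print,
p. 65 l. 36–37) tensor product over `ℚ_p` of the `ℚ_p`-algebras `B_{E′_w}` — a commutative ring (`PiTensorProduct.instCommRing`);
shows the abstract field `T` is instantiable by the printed construction. [claim: Joshi2024ATS3, status: disputed] -/
abbrev tensorModel : Type := ⨂[Qp] w : D.Vss, BE w.1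

/-- **MODEL of the §7.7.2 map** «`(x_w)_w ↦ ⊗_w x_w`» (p. 65 l. 40–56) for `tensorModel`: Mathlib's
`PiTensorProduct.tprodMonoidHom`, instantiating the abstract field `tprod`. [claim: Joshi2024ATS3, status: disputed] -/
def tensorModelTprod : D.BundleOdd →* D.tensorModel := PiTensorProduct.tprodMonoidHom Qp

/-- **§7.7.2 on `ℓ⋇`-tuples**: `(x_{w,j})_{w,j} ↦ (⊗_w x_{w,j})_j`, `(⊕_w B_{E′_w})^{ℓ⋇} → (B̆⊗_{L′,p})^{ℓ⋇}` («This can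
be applied to lifts of theta-values», p. 66 l. 7–17). [claim: Joshi2024ATS3, status: disputed] -/
def tprodTuple (z : Fin lstar → D.BundleOdd) : Fin lstar → T := fun j => D.tprod (z j)

/-- **(7.7.2.1) the tensor theta-values locus at `p`**: «the image of the theta-values locii `∏_{w} Θ̃^{B_{E′_w}}_{Joshi}`
in `(B̆⊗_{L′,p})^{ℓ⋇}`» (p. 66 l. 17–34) — the image of (7.5.3.1) under `tprodTuple`; (7.7.2.2), the `B̑⊗` twin, is the
same construction on the datum with `BE w := B_p ⊗_{ℚ_p} E′_w`. [claim: Joshi2024ATS3, status: disputed] -/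
def locusTensor : Set (Fin lstar → T) := D.tprodTuple '' D.locusBundled

/-- **(7.2.2) size of an `ℓ⋇`-tuple of `B_{E′_w}` at `ρ`**: `∏_{j=1}^{ℓ⋇} |x_j|_{B_{E′_w},ρ}` (p. 54 l. 9–18) — the reading of
`|Z_w|_{B_{E′_w},ρ}` in (7.7.3.3) under which proof and statement of Thm. 7.7.3.1 agree (PRINT NOTE (a)). [claim: Joshi2024ATS3, status: disputed] -/
def localSize (w : I) (ρ : ℝ) (x : Fin lstar → BE w) : ℝ := ∏ j, D.nrm w ρ (x j)

/-- **Size of an `ℓ⋇`-tuple of `B̆⊗_{L′,p}` at `ρ`**: `∏_j |t_j|_{B̆⊗,ρ}` — the (7.2.2) recipe on the tensor ring, used by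
Thm. 7.7.3.1 without restatement. [claim: Joshi2024ATS3, status: disputed] -/
def tupleNormT (ρ : ℝ) (t : Fin lstar → T) : ℝ := ∏ j, D.normT ρ (t j)


/-- **`|S|_{B̆⊗,ρ} := sup {|t|_ρ : t ∈ S}`** ((7.2.8) p. 54 l. 43–60; §7.6.7 p. 64 l. 51–58), in `EReal` (E-t12's convention; print: `ℝ ∪ {∞}`, p. 64 l. 54–58; `⊥` only for `S = ∅`, junk).
[claim: Joshi2024ATS3, status: disputed] -/
def sizeAt (S : Set (Fin lstar → T)) (ρ : ℝ) : EReal := ⨆ t ∈ S, ((D.tupleNormT ρ t : ℝ) : EReal)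

/-- **`|S|_{B̆⊗} := sup {|t|_ρ : t ∈ S, ρ ∈ (0,1]}`** ((7.2.9) p. 54 l. 61–76). [claim: Joshi2024ATS3, status: disputed] -/
def size (S : Set (Fin lstar → T)) : EReal := ⨆ ρ ∈ Set.Ioc (0 : ℝ) 1, D.sizeAt S ρ

/-- **Lemma 7.6.6.1, order-theoretic half (7.6.6.3), DERIVED** (p. 64 l. 27–37): the size of `S` at `ρ` dominates the
size of any member. [folklore] -/
theorem tupleNormT_le_sizeAt {S : Set (Fin lstar → T)} {t : Fin lstar → T} (ht : t ∈ S) (ρ : ℝ) :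
    ((D.tupleNormT ρ t : ℝ) : EReal) ≤ D.sizeAt S ρ :=
  le_iSup₂ (f := fun t (_ : t ∈ S) => ((D.tupleNormT ρ t : ℝ) : EReal)) t ht

/-- The size dominates the size at any `ρ ∈ (0,1]`. [folklore] -/
theorem sizeAt_le_size (S : Set (Fin lstar → T)) {ρ : ℝ} (hρ : ρ ∈ Set.Ioc (0 : ℝ) 1) :
    D.sizeAt S ρ ≤ D.size S :=
  le_iSup₂ (f := fun ρ (_ : ρ ∈ Set.Ioc (0 : ℝ) 1) => D.sizeAt S ρ) ρ hρ

/-- **(7.7.3.2) cross-norm property at `ρ`** (p. 66 l. 121–131: «Lemma 7.6.4.1, Lemma 7.6.5.1 show that `|⊗_{w|p} Z_w|_ρ =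
∏_{w|p} |Z_w|_ρ`»; J3 Thm. 7.6.2.2 (3)). HYPOTHESIS (E-t14's block; Mathlib has only the `≤` half,
`PiTensorProduct.projectiveSeminorm_tprod_le`), never asserted. [claim: Joshi2024ATS3, status: disputed] -/
@[claim "Joshi2024ATS3" "disputed"]
def CrossNormAt (ρ : ℝ) : Prop :=
  ∀ x : D.BundleOdd, D.normT ρ (D.tprod x) = ∏ w : D.Vss, D.nrm w.1 ρ (x w)

/-- **Per-`w` pilot lower bound at `ρ`** — the input «By [Joshi, 2023b, Theorem 9.2.1] … `Θ̃^{B̆}_{Joshi,p}` contains a pure tensor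
`⊗_{w|p} Z_w` such that `|Z_w|_{B_{E′_w},ρ} ≥ |q_w^{1/2ℓ}|_{ℂ_{p_w}}` [`^{ℓ⋇}`, PRINT NOTE (a)] with `Z_w` a theta-Pilot object for
`X/E′_w`» (p. 66 l. 104–120; (7.7.3.3)): for every `w ∈ 𝕍^{odd,ss}_p` some member of `Θ̃^{B_{E′_w}}_{Joshi}` has tuple-size
`≥ |q_w^{1/2ℓ}|^{ℓ⋇}`. HYPOTHESIS (arXiv:2303.01662 Thm. 9.2.1, E-t3's block), never asserted. [claim: Joshi2024ATS3, status: disputed] -/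
@[claim "Joshi2024ATS3" "disputed"]
def PilotLowerBoundAt (ρ : ℝ) : Prop :=
  ∀ w ∈ D.Vss, ∃ Z ∈ D.locusBE w, D.qRoot w ^ lstar ≤ D.localSize w ρ Z

/-- **Theorem 7.7.3.1, the factor at `p`** (p. 66 l. 62–103): `|Θ̃^{B̆⊗}_{Joshi,p}|_{B̆⊗} ≥ ∏_{w ∈ 𝕍^{odd,ss}_p}
|q_w^{1/2ℓ}|_{ℂ_{p_w}}^{ℓ⋇}`. CLAIM, never asserted; derivation: `localFundamentalEstimate_of_pilot_of_crossNorm`.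
[claim: Joshi2024ATS3, status: disputed] -/
@[claim "Joshi2024ATS3" "disputed"]
def LocalFundamentalEstimate : Prop :=
  (((∏ w ∈ D.Vss, D.qRoot w ^ lstar : ℝ) : ℝ) : EReal) ≤ D.size D.locusTensor

/-- Per-`w` witnesses assemble into ONE bundled tuple (product-set structure of (7.5.3.1)). [folklore] -/
theorem exists_mem_locusBundled_of_pilot {ρ : ℝ} (h : D.PilotLowerBoundAt ρ) :
    ∃ z ∈ D.locusBundled, ∀ w : D.Vss, D.qRoot w.1 ^ lstar ≤ D.localSize w.1 ρ (fun j => z j w) := by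
  choose Z hZmem hZle using h; exact ⟨fun j w => Z w.1 w.2 j, fun w => hZmem w.1 w.2, fun w => hZle w.1 w.2⟩

/-- **(7.7.3.2) ⇒ size of a pure-tensor tuple = product of component sizes** (reindexing `∏_j ∏_w = ∏_w ∏_j`; p. 66
l. 121 – p. 67 l. 13). [folklore] -/
theorem tupleNormT_tprodTuple_eq {ρ : ℝ} (hx : D.CrossNormAt ρ) (z : Fin lstar → D.BundleOdd) :
    D.tupleNormT ρ (D.tprodTuple z) = ∏ w : D.Vss, D.localSize w.1 ρ (fun j => z j w) := by
  calc D.tupleNormT ρ (D.tprodTuple z)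
      = ∏ j : Fin lstar, ∏ w : D.Vss, D.nrm w.1 ρ (z j w) :=
        Finset.prod_congr rfl fun j _ => hx (z j)
    _ = ∏ w : D.Vss, ∏ j : Fin lstar, D.nrm w.1 ρ (z j w) := Finset.prod_comm
    _ = ∏ w : D.Vss, D.localSize w.1 ρ (fun j => z j w) := rfl

/-- **Theorem 7.7.3.1 at `p`, DERIVED in kernel from the two inputs its proof names** (p. 66 l. 104 – p. 67 l. 47): the per-`w`
pilot lower bound at some `ρ ∈ (0,1]` and the cross-norm property at that `ρ` give the estimate — via ONE exhibited member (the
pure tensor of the witnesses), «sup ≥ member» (Lem. 7.6.6.1) and product monotonicity. The inputs stay hypotheses. [folklore] -/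
theorem localFundamentalEstimate_of_pilot_of_crossNorm {ρ : ℝ} (hρ : ρ ∈ Set.Ioc (0 : ℝ) 1)
    (hZ : D.PilotLowerBoundAt ρ) (hx : D.CrossNormAt ρ) : D.LocalFundamentalEstimate := by
  obtain ⟨z, hzmem, hzle⟩ := D.exists_mem_locusBundled_of_pilot hZ
  have hprod : (∏ w ∈ D.Vss, D.qRoot w ^ lstar) ≤ D.tupleNormT ρ (D.tprodTuple z) := by
    rw [D.tupleNormT_tprodTuple_eq hx z, ← Finset.prod_coe_sort D.Vss]
    exact Finset.prod_le_prod (fun w _ => pow_nonneg (D.qRoot_pos w.1 w.2).le _) fun w _ => hzle w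
  unfold LocalFundamentalEstimate
  calc (((∏ w ∈ D.Vss, D.qRoot w ^ lstar : ℝ) : ℝ) : EReal)
      ≤ ((D.tupleNormT ρ (D.tprodTuple z) : ℝ) : EReal) := EReal.coe_le_coe_iff.2 hprod
    _ ≤ D.sizeAt D.locusTensor ρ := D.tupleNormT_le_sizeAt (Set.mem_image_of_mem _ hzmem) ρ
    _ ≤ D.size D.locusTensor := D.sizeAt_le_size _ hρ

end PrimeBundlingDatum

/-! ## 2. All rational primes at once ((7.5.1.6), Thm. 7.5.4.2, (7.7.2.1), Thm. 7.7.3.1) -/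

/-- **`PrimeBundlingFamily lstar` — the local data for every rational prime `p`** («I will work with all the primes `w|p` in `𝕍`
simultaneously», p. 57 l. 64–65): a family `loc p` over an abstract type `P` of rational primes and the FINITE set `support` of the
`p` with `𝕍^{odd,ss}_p ≠ ∅` («The set of such rational primes `p` is finite», p. 55 l. 31–35; «both the products are over a finite
set of rational primes `p`», p. 66 l. 59). SIGNATURE ONLY. [claim: Joshi2024ATS3, status: disputed] -/
structure PrimeBundlingFamily (lstar : ℕ) (P : Type) (Qp Bp : P → Type) [∀ p, Field (Qp p)] [∀ p, CommRing (Bp p)]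
    [∀ p, Algebra (Qp p) (Bp p)] (I : P → Type) [∀ p, Fintype (I p)] [∀ p, DecidableEq (I p)] (E BE : (p : P) → I p → Type)
    [∀ p w, Field (E p w)] [∀ p w, Algebra (Qp p) (E p w)] [∀ p w, CommRing (BE p w)] [∀ p w, Algebra (Qp p) (BE p w)]
    [∀ p w, Algebra (Bp p) (BE p w)] (T : P → Type) [∀ p, CommRing (T p)] : Type where
  /-- the local bundling data at the rational prime `p` (carriers `ℚ_p`, `B_p`, `𝕍_{L′,p}`, `E′_w`, `B_{E′_w}`, `B̆⊗_{L′,p}` per `p`) -/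
  loc : (p : P) → PrimeBundlingDatum lstar (Qp p) (Bp p) (I p) (E p) (BE p) (T p)
  /-- the finite set of `p` with `𝕍^{odd,ss}_p ≠ ∅` -/
  support : Finset P
  /-- … characterised as such -/
  mem_support_iff : ∀ p : P, p ∈ support ↔ (loc p).Vss.Nonempty

namespace PrimeBundlingFamily

variable {lstar : ℕ} {P : Type} {Qp Bp : P → Type} [∀ p, Field (Qp p)] [∀ p, CommRing (Bp p)] [∀ p, Algebra (Qp p) (Bp p)]
  {I : P → Type} [∀ p, Fintype (I p)] [∀ p, DecidableEq (I p)] {E BE : (p : P) → I p → Type} [∀ p w, Field (E p w)]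
  [∀ p w, Algebra (Qp p) (E p w)] [∀ p w, CommRing (BE p w)] [∀ p w, Algebra (Qp p) (BE p w)] [∀ p w, Algebra (Bp p) (BE p w)]
  {T : P → Type} [∀ p, CommRing (T p)] (A : PrimeBundlingFamily lstar P Qp Bp I E BE T)

/-- **(7.5.1.6) `B_{L′} = ∏_{p ∈ 𝕍_ℚ} B̆_{L′,p}`** (p. 58 l. 58–62): the adelic carrier regrouped by the rational prime below `w` —
here its DEFINITION (product ring); the identification with E-t11's `B_{L′} = ∏_{w ∈ 𝕍_{L′}} B_{L′_w}` (J3 Def. 6.9.1) is the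
regrouping `∏_w = ∏_p ∏_{w|p}` (merge-debt). [claim: Joshi2024ATS3, status: disputed] -/
abbrev AdelicBundleAll (_ : PrimeBundlingFamily lstar P Qp Bp I E BE T) : Type := (p : P) → (w : I p) → BE p w

/-- **Thm. 7.5.4.2, global clause** (p. 60 l. 41–51: «`Θ̃^{B_{L′}}_{Joshi} = ∏_p Θ̃_{Joshi,p} ⊂ ∏_p B̆_p^{ℓ⋇} = B_{L′}^{ℓ⋇}`»): the
product over the support of the local bundled loci (outside the support the factors are trivial, §7.6.8 p. 64 l. 59–67, and
omitted from the index). The EQUALITY with E-t11's adelic locus (J3 Def. 6.10.2) is what Thm. 7.5.4.2 asserts («one has proved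
the following theorem», p. 60 l. 26) — merge-debt, not typed here. [claim: Joshi2024ATS3, status: disputed] -/
def adelicLocusBundled : Set ((p : A.support) → Fin lstar → (A.loc p.1).BundleOdd) :=
  Set.pi Set.univ fun p => (A.loc p.1).locusBundled

/-- **(7.7.2.1) the adelic tensor locus `Θ̃^{B̆⊗}_{Joshi} ⊂ ∏_{p, 𝕍^{odd,ss}_p ≠ ∅} (B̆⊗_{L′,p})^{ℓ⋇}`** (p. 66 l. 35–47):
the product over the support of the local tensor loci; (7.7.2.2) = the same on the `B̑⊗` twin data.
[claim: Joshi2024ATS3, status: disputed] -/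
def adelicLocusTensor : Set ((p : A.support) → Fin lstar → T p.1) :=
  Set.pi Set.univ fun p => (A.loc p.1).locusTensor

/-- **Adelic size of a tuple at `ρ`**: `∏_p |t_p|_{B̆⊗_{L′,p},ρ}` ((7.2.3)/(7.2.6) p. 54 l. 23–42; §7.6.7 p. 64 l. 38–58).
[claim: Joshi2024ATS3, status: disputed] -/
def tupleNorm (ρ : ℝ) (t : (p : A.support) → Fin lstar → T p.1) : ℝ :=
  ∏ p : A.support, (A.loc p.1).tupleNormT ρ (t p)

/-- **`|S|_ρ := sup {|t|_ρ : t ∈ S}`** for `S ⊂ ∏_p (B̆⊗_{L′,p})^{ℓ⋇}` ((7.2.8); §7.6.7), in `EReal` (E-t12's convention; print: `ℝ ∪ {∞}`, p. 64 l. 54–58; `⊥` only for `S = ∅`, junk).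
[claim: Joshi2024ATS3, status: disputed] -/
def sizeAt (S : Set ((p : A.support) → Fin lstar → T p.1)) (ρ : ℝ) : EReal :=
  ⨆ t ∈ S, ((A.tupleNorm ρ t : ℝ) : EReal)

/-- **`|S|_{B̆⊗} := sup {|t|_ρ : t ∈ S, ρ ∈ (0,1]}`** ((7.2.9)) — the quantity Thm. 7.7.3.1 bounds.
[claim: Joshi2024ATS3, status: disputed] -/
def size (S : Set ((p : A.support) → Fin lstar → T p.1)) : EReal :=
  ⨆ ρ ∈ Set.Ioc (0 : ℝ) 1, A.sizeAt S ρ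

/-- **THEOREM 7.7.3.1 (the fundamental estimate, tensor form)**, as printed (p. 66 l. 62–103): «Let `C/L` be an elliptic curve
and suppose `ℓ` is an odd prime such that §2.4, §3.1, §3.3 hold for `C, L, ℓ`. Let `L′/L` be the finite extension of `L` defined in
§3.1, §3.3. For any `w ∈ 𝕍^{odd,ss}`, let `p_w` be the rational prime lying below `w`. Choose a normalization … such that for any
uniformizer `π_w ∈ 𝒪_{L′_w}` one has `|π_w|_{ℂ_{p_w}} = p_w^{-1}`. Let `Θ̃^{B_{L′}}_{Joshi}` be the adelic theta-values locus for the
ring `B_{L′}` (defined in Definition 6.10.2). Then `|Θ̃^{B̆⊗}_{Joshi}|_{B̆⊗} ≥ ∏_{w ∈ 𝕍^{odd,ss}} |q_w^{1/2ℓ}|_{ℂ_{p_w}}^{ℓ⋇}`, and a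
similar assertion for `|Θ̃^{B̑⊗}_{Joshi}|_{B̑⊗}`.» Right side grouped `∏_{p ∈ support} ∏_{w ∈ 𝕍^{odd,ss}_p}`. CLAIM of an unrefereed,
disputed source — NEVER ASSERTED; derivation: `fundamentalEstimateTensor_of_pilot_of_crossNorm`. [claim: Joshi2024ATS3, status: disputed] -/
@[claim "Joshi2024ATS3" "disputed"]
def FundamentalEstimateTensor : Prop :=
  (((∏ p : A.support, ∏ w ∈ (A.loc p.1).Vss, (A.loc p.1).qRoot w ^ lstar : ℝ) : ℝ) : EReal)
    ≤ A.size A.adelicLocusTensor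

/-- **Input 1 of the proof**: «for each `0 < ρ < 1` and each `p` for which `𝕍^{odd,ss}_p ≠ ∅` and each `w ∈ 𝕍^{odd,ss}_p`
one has the lower bound (7.7.3.3)» (p. 67 l. 1–13). HYPOTHESIS, never asserted. [claim: Joshi2024ATS3, status: disputed] -/
@[claim "Joshi2024ATS3" "disputed"]
def PilotLowerBound : Prop := ∀ ρ ∈ Set.Ioo (0 : ℝ) 1, ∀ p : A.support, (A.loc p.1).PilotLowerBoundAt ρ

/-- **Input 2 of the proof**: the cross-norm property (7.7.3.2) at every `p` of the support and every `ρ ∈ [0,1]`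
(Lem. 7.6.4.1 / 7.6.5.1, p. 62 l. 30). HYPOTHESIS (E-t14's block), never asserted. [claim: Joshi2024ATS3, status: disputed] -/
@[claim "Joshi2024ATS3" "disputed"]
def CrossNorm : Prop := ∀ ρ ∈ Set.Icc (0 : ℝ) 1, ∀ p : A.support, (A.loc p.1).CrossNormAt ρ

/-- «sup ≥ member» adelically (Lem. 7.6.6.1 (7.6.6.3)). [folklore] -/
theorem tupleNorm_le_sizeAt {S : Set ((p : A.support) → Fin lstar → T p.1)}
    {t : (p : A.support) → Fin lstar → T p.1} (ht : t ∈ S) (ρ : ℝ) :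
    ((A.tupleNorm ρ t : ℝ) : EReal) ≤ A.sizeAt S ρ :=
  le_iSup₂ (f := fun t (_ : t ∈ S) => ((A.tupleNorm ρ t : ℝ) : EReal)) t ht

/-- The adelic size dominates the size at any `ρ ∈ (0,1]`. [folklore] -/
theorem sizeAt_le_size (S : Set ((p : A.support) → Fin lstar → T p.1)) {ρ : ℝ}
    (hρ : ρ ∈ Set.Ioc (0 : ℝ) 1) : A.sizeAt S ρ ≤ A.size S :=
  le_iSup₂ (f := fun ρ (_ : ρ ∈ Set.Ioc (0 : ℝ) 1) => A.sizeAt S ρ) ρ hρ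

/-- **THEOREM 7.7.3.1 DERIVED in kernel from the inputs its proof names** (p. 66 l. 104 – p. 67 l. 47): the per-`w` pilot lower
bounds (at one `ρ ∈ (0,1)`) and the cross-norm property imply the fundamental estimate — by exhibiting ONE member of `Θ̃^{B̆⊗}_{Joshi}`
(the tuple of pure tensors of the witnesses; (7.7.3.4) «taking products over all `p` for which `𝕍^{odd,ss}_p ≠ ∅`»), «sup ≥ member»
(Lem. 7.6.6.1) and monotonicity of finite products. The COMPOSITION is checked; the inputs stay hypotheses. [folklore] -/
theorem fundamentalEstimateTensor_of_pilot_of_crossNorm (hZ : A.PilotLowerBound) (hx : A.CrossNorm) :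
    A.FundamentalEstimateTensor := by
  classical
  have hρo : (1 / 2 : ℝ) ∈ Set.Ioo (0 : ℝ) 1 := by constructor <;> norm_num
  have hρc : (1 / 2 : ℝ) ∈ Set.Ioc (0 : ℝ) 1 := Set.Ioo_subset_Ioc_self hρo
  have hw : ∀ p : A.support, ∃ z ∈ (A.loc p.1).locusBundled,
      ∀ w : (A.loc p.1).Vss, (A.loc p.1).qRoot w.1 ^ lstar ≤
        (A.loc p.1).localSize w.1 (1 / 2) (fun j => z j w) :=
    fun p => (A.loc p.1).exists_mem_locusBundled_of_pilot (hZ (1 / 2) hρo p)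
  choose z hzmem hzle using hw
  let t : (p : A.support) → Fin lstar → T p.1 := fun p => (A.loc p.1).tprodTuple (z p)
  have htmem : t ∈ A.adelicLocusTensor := fun p _ => Set.mem_image_of_mem _ (hzmem p)
  have hprod : (∏ p : A.support, ∏ w ∈ (A.loc p.1).Vss, (A.loc p.1).qRoot w ^ lstar)
      ≤ A.tupleNorm (1 / 2) t := by
    unfold tupleNorm
    refine Finset.prod_le_prod (fun p _ => Finset.prod_nonneg fun w hw =>
      pow_nonneg ((A.loc p.1).qRoot_pos w hw).le _) fun p _ => ?_
    show (∏ w ∈ (A.loc p.1).Vss, (A.loc p.1).qRoot w ^ lstar)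
      ≤ (A.loc p.1).tupleNormT (1 / 2) ((A.loc p.1).tprodTuple (z p))
    rw [(A.loc p.1).tupleNormT_tprodTuple_eq (hx (1 / 2) (Set.Ioo_subset_Icc_self hρo) p) (z p),
      ← Finset.prod_coe_sort (A.loc p.1).Vss]
    exact Finset.prod_le_prod (fun w _ => pow_nonneg ((A.loc p.1).qRoot_pos w.1 w.2).le _)
      fun w _ => hzle p w
  unfold FundamentalEstimateTensor
  calc (((∏ p : A.support, ∏ w ∈ (A.loc p.1).Vss, (A.loc p.1).qRoot w ^ lstar : ℝ) : ℝ) : EReal)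
      ≤ ((A.tupleNorm (1 / 2) t : ℝ) : EReal) := EReal.coe_le_coe_iff.2 hprod
    _ ≤ A.sizeAt A.adelicLocusTensor (1 / 2) := A.tupleNorm_le_sizeAt htmem _
    _ ≤ A.size A.adelicLocusTensor := A.sizeAt_le_size _ hρc

end PrimeBundlingFamily

end Summit.ABC.IUTFork.Joshi.ATS3

end
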